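import Literature.AlgebraicGeometry.Frobenioids.DegreeModelFrobenioid
import Literature.AlgebraicGeometry.Frobenioids.ModelFrobenioidUntr
import Literature.AlgebraicGeometry.Frobenioids.ModelFrobenioidRationallyStandardProofs
import Literature.AlgebraicGeometry.Frobenioids.BaseIdentityPreStepsSlim
import Mathlib.CategoryTheory.SingleObj
import Mathlib.CategoryTheory.PUnit
import Mathlib.GroupTheory.SpecificGroups.Dihedral
import HarnessLib

/-!
# Frobenioids I, Thm. 5.2 (iii) (second sentence) and Prop. 5.5 (iv): the schema parameters are
# load-bearing — kernel status of FACT-LIST rows F-1121 `RationallyStandardTypeIff'` and F-2690 `IsImageOfDivB`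

Mochizuki, *The geometry of Frobenioids I: the general theory*, Kyushu J. Math. **62** (2008)
293–400, §5: Theorem 5.2 (iii), kurims p. 101 (proof p. 103) and Proposition 5.5 (iv), p. 104
[cite: MochizukiFrdI2008, Thm. 5.2(iii) p.101] [cite: MochizukiFrdI2008, Prop. 5.5 (iv) p.104].

PROOF-ONLY companion (abc-iut cell, block F fact-proving wave, tranche 42).  Both rows are typed in the
tree as SCHEMATA over data interfaces, faithful to print only at THE constructions:

* `ModelFrobenioid.RationallyStandardTypeIff' Φ B DivB R` (`ModelFrobenioidStandard.lean`) — Thm. 5.2 (iii),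
  second sentence, over a parameter `R : RSParams` (birationalization datum `R.B`, support predicate,
  operations and birationalization of `C^un-tr`); its docstring says "SCHEMA ONLY in the data-interface
  `RSParams`".  INSTANCE FORM PROVED in the tree, unconditionally from the standing hypotheses of Thm. 5.2,
  for every `R` whose `R.B` is THE birationalization `C → C^birat` of Prop. 4.4:
  `ModelFrobenioid.rationallyStandardTypeIff'_biratData_of_hypotheses` /
  `ModelFrobenioid.isOfRationallyStandardType_iff_biratData` (`ModelFrobenioidRationallyStandardProofs.lean`).
* `ModelFrobenioid.IsImageOfDivB Φ B DivB Ψ` (`ModelFrobenioidUntr.lean`) — the HYPOTHESIS "`Φ^birat ⊆ Φ^gp`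
  is the image of `Div_B`" of Prop. 5.5 (iv), for a subfunctor of groups `Ψ`.  INSTANCE FORMS PROVED in
  the tree: `ModelFrobenioid.isImageOfDivB_imageGpSubfunctor` (the image subfunctor itself) and
  `ModelFrobenioid.isImageOfDivB_biratSubfunctor` (`ModelFrobenioidBirat.lean`, `Φ^birat` of THE
  birationalization, `B` group-like).

Here, in kernel, over the degree model `DegreeModel.C` = the model Frobenioid of `(pt, ℕ, 0, 0)`
(`DegreeModelFrobenioid.lean`: the hypotheses of Thm. 5.2 hold, `C` is a Frobenioid OF STANDARD TYPE):

* the instance forms, specialised (`isImageOfDivB_degreeModel_image`,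
  `rationallyStandardTypeIff'_degreeModel_biratData`);
* **the UNIVERSAL CLOSURES are FALSE as typed**: the subfunctor `⊤ ⊆ ℕ^gp` is not the image of
  `Div_B = 0` (`not_isImageOfDivB_top`, `not_forall_isImageOfDivB`); and for the junk parameter `R` whose
  `R.B` is a FAKE birationalization — one object whose endomorphism monoid is the (non-commutative) dihedral
  group of order 6, all arrows of Frobenius degree 1, over the zero monoid — conditions (a) "rational and
  standard type" and (b) "`(C^un-tr)^birat` admits a Frobenius-compact object" hold while "rationally
  standard type" fails (its clause "birationally Frobenius-normalized", Def. 4.5 (i), asks the degree-1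
  endomorphisms of the fake `A^birat` to commute), so the printed `iff` fails for that `R`
  (`not_forall_rationallyStandardTypeIff'`).

Reading: both rows are consumable only in instance form (plan R5); refuting OUR universal closure over a
data-only interface is not a statement about print — at THE birationalization the sentence is PROVED.
No statement of the paper is strengthened; monoids multiplicative; composition diagrammatic.
-/

namespace Literature.AlgebraicGeometry.Frobenioids

open CategoryTheory Opposite

namespace DegreeModel

/-! ### Prop. 5.5 (iv): the hypothesis `IsImageOfDivB` (FACT-LIST F-2690) -/

/-- Instance form at the degree model: the image subfunctor `Div_B(B) ⊆ Φ^gp` IS the image of `Div_B`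
(abc-iut-L1-t2's `isImageOfDivB_imageGpSubfunctor`, specialised). [cite: MochizukiFrdI2008, Prop. 5.5 (iv) p.104] -/
theorem isImageOfDivB_degreeModel_image :
    ModelFrobenioid.IsImageOfDivB natΦ B DivB
      (ModelFrobenioid.imageGpSubfunctor natΦ B DivB objectwise_isGroupLike_B) :=
  ModelFrobenioid.isImageOfDivB_imageGpSubfunctor objectwise_isGroupLike_B

/-- The subfunctor of groups `⊤ ⊆ Φ^gp = ℕ^gp` over the degree model is NOT the image of `Div_B = 0`:
`1 ∈ ℕ ⊆ ℕ^gp` lies in `⊤` but not in `Div_B(0) = {0}`. [cite: MochizukiFrdI2008, Prop. 5.5 (iv) p.104] -/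
theorem not_isImageOfDivB_top :
    ¬ ModelFrobenioid.IsImageOfDivB natΦ B DivB
        { carrier := fun _ => ⊤, pull_mem := fun _ _ _ => Subgroup.mem_top _ } := by
  intro h
  obtain ⟨u, hu⟩ := (h pt (Algebra.GrothendieckGroup.of (Multiplicative.ofAdd (1 : ℕ)))).mp
    (Subgroup.mem_top _)
  rw [divB_eq_one] at hu
  have hu' : (1 : Algebra.GrothendieckGroup N) =
      Algebra.GrothendieckGroup.of (M := N) (Multiplicative.ofAdd (1 : ℕ)) := hu
  have h1 : (Multiplicative.ofAdd (1 : ℕ) : N) = 1 :=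
    Algebra.GrothendieckGroup.of_injective
      (hu'.symm.trans (map_one (Algebra.GrothendieckGroup.of (M := N))).symm)
  exact Nat.one_ne_zero (congrArg Multiplicative.toAdd h1)

/-- **The universal closure of FACT-LIST row F-2690 is false**: "every subfunctor of groups `Ψ ⊆ Φ^gp` is
the image of `Div_B`" fails at `Ψ = ⊤` over the degree model `(pt, ℕ, 0, 0)`.  `IsImageOfDivB` is the
HYPOTHESIS of Prop. 5.5 (iv) (its instance forms are proved in the tree); this refutes OUR universal
closure, not a statement of the paper. [cite: MochizukiFrdI2008, Prop. 5.5 (iv) p.104] -/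
theorem not_forall_isImageOfDivB :
    ¬ ∀ (D : Type) [Category.{0} D] (Φ B : Dᵒᵖ ⥤ CommMonCat.{0}) (DivB : B ⟶ monoidGp Φ)
        (Ψ : GpSubfunctor Φ), ModelFrobenioid.IsImageOfDivB Φ B DivB Ψ :=
  fun h => not_isImageOfDivB_top (h _ natΦ B DivB _)

/-! ### Thm. 5.2 (iii), second sentence: the schema `RationallyStandardTypeIff'` (FACT-LIST F-1121) -/

/-- Instance form at the degree model: for every parameter `R` whose birationalization datum is THE
birationalization `C → C^birat` of Prop. 4.4, the second sentence of Thm. 5.2 (iii) holds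
(abc-iut-L1-d10's `rationallyStandardTypeIff'_biratData`, specialised). [cite: MochizukiFrdI2008, Thm. 5.2(iii) p.103] -/
theorem rationallyStandardTypeIff'_degreeModel_biratData
    (R : (ModelFrobenioid.data natΦ B DivB).RSParams)
    (hRB : R.B = PreFrobenioid.biratData hF (PreFrobenioid.hasBiratSquares_of_isFrobenioid hF)) :
    ModelFrobenioid.RationallyStandardTypeIff' natΦ B DivB R :=
  ModelFrobenioid.rationallyStandardTypeIff'_biratData natΦ B DivB hF _ R hRB

/-- In the dihedral group of order 6 the rotation `r 1` and the reflection `sr 0` do not commute.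
[folklore] -/
private theorem dihedral_three_not_comm :
    ¬ ((DihedralGroup.r 1 : DihedralGroup 3) * DihedralGroup.sr 0 = DihedralGroup.sr 0 * DihedralGroup.r 1) := by
  decide

/-- A FAKE birationalization datum of the degree model (the data-only interface `BiratData` of Prop. 4.4
admits junk instances): `C^birat` := the one-object category of the dihedral group of order 6, all arrows
of Frobenius degree `1` over the zero monoid, `Φ^birat := ⊤`, divisor maps trivial.  Its unique object is
NOT Frobenius-normalized (Def. 1.2 (iv): degree-1 base-identity endomorphisms would have to commute), so
the degree model is not "birationally Frobenius-normalized" with respect to it (Def. 4.5 (i)).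
[cite: MochizukiFrdI2008, Prop. 4.4 p.82] -/
theorem exists_biratData_not_biratFrobeniusNormalized :
    ∃ Bj : (ModelFrobenioid.data natΦ B DivB).BiratData.{0, 0, 0, 0, 0, 0},
      (∀ X, Bj.phiBirat X = ⊤) ∧ ¬ PreFrobenioidData.IsOfBiratFrobeniusNormalizedType Bj := by
  refine ⟨{ Birat := SingleObj (DihedralGroup 3)
            toBirat := (Functor.const _).obj (SingleObj.star _)
            obj_surjective := fun Y => ⟨ι 0, Quiver.SingleObj.ext⟩
            ops :=
              { base := (Functor.const _).obj pt
                Mon := fun _ => PUnit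
                pull := fun _ => MonoidHom.id _
                pull_id := fun _ _ => rfl
                pull_comp := fun _ _ _ => rfl
                div := fun _ => PUnit.unit
                degFr := fun _ => 1
                div_id := fun _ => rfl
                div_comp := fun _ _ => rfl
                degFr_id := fun _ => rfl
                degFr_comp := fun _ _ => rfl }
            ops_mon_eq_one := fun _ _ => rfl
            overBase := Functor.punitExt _ _
            phiBirat := fun _ => ⊤
            divBirat := fun _ => 1
            divBirat_mem := fun _ _ => Subgroup.mem_top _ }, fun _ => rfl, ?_⟩
  intro hbfn
  have h := hbfn.obj (ι 0) (DihedralGroup.sr 0 : DihedralGroup 3) (Subsingleton.elim _ _)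
    (DihedralGroup.r 1 : DihedralGroup 3) ⟨Subsingleton.elim _ _, rfl⟩
  have h2 : (DihedralGroup.r 1 : End (SingleObj.star (DihedralGroup 3))) ^ (1 : ℕ) *
      (DihedralGroup.sr 0 : DihedralGroup 3) = (DihedralGroup.sr 0 : DihedralGroup 3) * DihedralGroup.r 1 := h
  rw [pow_one] at h2
  exact dihedral_three_not_comm h2

/-- Junk operations on `C^un-tr` together with a junk birationalization `(C^un-tr)^birat` of the degree
model that DOES admit a Frobenius-compact object: the one-object category of `(ℤ, +)`, all arrows of degree
`1` over the zero monoid — `O^×` is `ℤ`, commutative and non-torsion, and every automorphism centralises it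
(Def. 1.2 (iv)). [cite: MochizukiFrdI2008, Def. 1.2 (iv) p.23] -/
theorem exists_untr_biratData_frobeniusCompact :
    ∃ (SU : PreFrobenioidData.{0} (ModelFrobenioid.data natΦ B DivB).Untr D)
      (BU : SU.BiratData.{0, 0, 0, 0, 0, 0}), ∃ Y : BU.Birat, BU.ops.IsFrobeniusCompact Y := by
  refine ⟨{ base := (Functor.const _).obj pt
            Mon := fun _ => PUnit
            pull := fun _ => MonoidHom.id _
            pull_id := fun _ _ => rfl
            pull_comp := fun _ _ _ => rfl
            div := fun _ => PUnit.unit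
            degFr := fun _ => 1
            div_id := fun _ => rfl
            div_comp := fun _ _ => rfl
            degFr_id := fun _ => rfl
            degFr_comp := fun _ _ => rfl },
    { Birat := SingleObj (Multiplicative ℤ)
      toBirat := (Functor.const _).obj (SingleObj.star _)
      obj_surjective := fun Y =>
        ⟨(ModelFrobenioid.data natΦ B DivB).toUntr.obj
            ⟨ι 0, (PreFrobenioidData.ofFunctor_isIsotropic _ _).mpr
              (ModelFrobenioid.isIsotropic objectwise_isGroupLike_B _)⟩,
          Quiver.SingleObj.ext⟩
      ops :=
        { base := (Functor.const _).obj pt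
          Mon := fun _ => PUnit
          pull := fun _ => MonoidHom.id _
          pull_id := fun _ _ => rfl
          pull_comp := fun _ _ _ => rfl
          div := fun _ => PUnit.unit
          degFr := fun _ => 1
          div_id := fun _ => rfl
          div_comp := fun _ _ => rfl
          degFr_id := fun _ => rfl
          degFr_comp := fun _ _ => rfl }
      ops_mon_eq_one := fun _ _ => rfl
      overBase := Functor.punitExt _ _
      phiBirat := fun _ => ⊤
      divBirat := fun _ => 1
      divBirat_mem := fun _ _ => Subgroup.mem_top _ }, SingleObj.star (Multiplicative ℤ), ?_⟩
  -- `Aut` of the unique object is `(ℤ, +)`: commutative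
  have hcomm : ∀ a b : Aut (SingleObj.star (Multiplicative ℤ)), a * b = b * a := fun a b => by
    obtain ⟨x, rfl⟩ := (Units.toAut (Multiplicative ℤ)).surjective a
    obtain ⟨y, rfl⟩ := (Units.toAut (Multiplicative ℤ)).surjective b
    rw [← map_mul, ← map_mul, mul_comm]
  -- the unit `1 ∈ ℤ` gives a non-torsion automorphism
  have hnt : ∀ N : ℕ, 0 < N →
      (Units.toAut (Multiplicative ℤ) (toUnits (Multiplicative.ofAdd (1 : ℤ)))) ^ N ≠ 1 := by
    intro N hN hN1
    rw [← map_pow, ← map_pow, MulEquiv.map_eq_one_iff, MulEquiv.map_eq_one_iff, ← ofAdd_nsmul]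
      at hN1
    have h' : (N : ℤ) = 0 := by simpa using congrArg Multiplicative.toAdd hN1
    omega
  -- every automorphism centralises `O^×`
  have hcent : ∀ f u : Aut (SingleObj.star (Multiplicative ℤ)), (f * u * f⁻¹) ^ 1 = u ^ 1 :=
    fun f u => by rw [pow_one, pow_one, hcomm f u, mul_inv_cancel_right]
  exact ⟨fun u _ u' _ => hcomm u u',
    ⟨Units.toAut (Multiplicative ℤ) (toUnits (Multiplicative.ofAdd (1 : ℤ))),
      ⟨Subsingleton.elim _ _, rfl⟩, hnt⟩,
    fun f _ _ _ u _ => ⟨1, one_pos, hcent f u⟩⟩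

/-- **The universal closure of FACT-LIST row F-1121 is false**: there is a parameter `R : RSParams` of the
degree model `(pt, ℕ, 0, 0)` — `R.B` the fake birationalization above, `Supp(a) ∋ 𝔭 :⟺ a ≠ 0`, junk
`C^un-tr` data admitting a Frobenius-compact object — for which the typed second sentence of Thm. 5.2 (iii)
FAILS: the hypotheses of Thm. 5.2 hold (`DegreeModel.hypotheses`), (a) every object is rational and `C`
is of standard type (`DegreeModel.isOfStandardType`) and (b) holds, but "rationally standard type" w.r.t.
`R` fails since its clause "birationally Frobenius-normalized" (Def. 4.5 (i)) fails for the fake `R.B`.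
`RationallyStandardTypeIff'` is a SCHEMA in `R` (faithful at THE birationalization, where it is PROVED:
`rationallyStandardTypeIff'_degreeModel_biratData`); this refutes OUR universal closure over the data
interface, not a statement of the paper. [cite: MochizukiFrdI2008, Thm. 5.2(iii) p.101] -/
theorem not_forall_rationallyStandardTypeIff' :
    ¬ ∀ R : (ModelFrobenioid.data natΦ B DivB).RSParams.{0, 0, 0, 0, 0, 0},
        ModelFrobenioid.RationallyStandardTypeIff' natΦ B DivB R := by
  intro h
  obtain ⟨Bj, hphi, hnot⟩ := exists_biratData_not_biratFrobeniusNormalized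
  obtain ⟨SU, BU, Y, hY⟩ := exists_untr_biratData_frobeniusCompact
  let R : (ModelFrobenioid.data natΦ B DivB).RSParams := ⟨Bj, fun a _ => a ≠ 1, SU, BU⟩
  have hrat : ∀ A : C, PreFrobenioidData.IsRational R.B R.Supp A := fun A =>
    ⟨A, 𝟙 A, PreFrobenioidData.isPullbackMorphism_id _ A, fun 𝔭 =>
      ⟨(Multiplicative.ofAdd (1 : ℕ) : N), 1, by rw [hphi]; exact Subgroup.mem_top _,
        fun h1 => Nat.one_ne_zero (congrArg Multiplicative.toAdd h1), fun h1 => h1 rfl⟩⟩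
  have hiff : _ ↔ _ := h R hypotheses
  have hR : (ModelFrobenioid.data natΦ B DivB).IsOfRationallyStandardType R :=
    hiff.mpr ⟨⟨hrat, isOfStandardType⟩, Y, hY⟩
  exact hnot hR.biratFrobNormalized

/-- The same refutation, read as the closure over ALL model-Frobenioid data `(D, Φ, B, Div_B, R)`.
[cite: MochizukiFrdI2008, Thm. 5.2(iii) p.101] -/
theorem not_forall_rationallyStandardTypeIff'_allData :
    ¬ ∀ (D : Type) [Category.{0} D] (Φ B : Dᵒᵖ ⥤ CommMonCat.{0}) (DivB : B ⟶ monoidGp Φ)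
        (R : (ModelFrobenioid.data Φ B DivB).RSParams.{0, 0, 0, 0, 0, 0}),
        ModelFrobenioid.RationallyStandardTypeIff' Φ B DivB R :=
  fun h => not_forall_rationallyStandardTypeIff' (h _ natΦ B DivB)

end DegreeModel

end Literature.AlgebraicGeometry.Frobenioids
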